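/-
Copyright (c) 2026 the pub-hodgecm-mathlib formalisation cell (harness21).  Prover seat hodgecm-mathlib-R90-IF-p01 (g0), programme R90-TF, section S9 «InnerForm-13.3.6 (c)»,
deal «G′-DATUM FIELDS (C5 posit-and-construct) for the DEFINITE INNER FORM», EDITION 2 — SCOPE (RULING R90-IF-plan 2026-09-04T21:39:45Z (2); predicate text R90-IF-typ2 21:43:35Z).
-/
import Summits.HodgeConjecture.HodgeConjecture.Theorems.R90S9InnerFormSec146Data          -- ★ p862078 (this seat, edition 1): `RepPrimeClass`, `classOf`, `classOf_surjective`, `mPrime`, `mPrime_ne_zero`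
import Literature.NumberTheory.Automorphic.DiscreteAutomorphicRepNormalFixedVectors                 -- ★ `DiscreteAutomorphicRep.rightRegular_eq_self_of_normal`, `normal_cmCompactFactor` (ED. 3 feeder)
import HarnessLib

/-!
# R90-TF · S9 — the `G′`-datum of §14.6 for the definite inner form `U(H)`, EDITION 2, SCOPE: the `K_c`-SPHERICAL discrete classes `Rep′_sph ⊂ Rep′`
# (Rogawski 1990 §14.2 p. 232, §14.5 p. 237, §14.6 p. 244; Borel–Jacquet 1979 §4.6)

Cell `hodgecm-mathlib`, crux H413 = `stmt-HodgeConjecture-24833` (supports-only, count-neutral), route `HCCMUnconditional`; programme R90-TF, section S9, seat R90-IF-p01 (g0).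
DEFINITIONS + unfolding laws (`--kind definition`, review lane); no instance, no notation, no named-fact hypothesis, no `sorry`.  Sibling of ★ `R90S9InnerFormSec146Data`
(edition 1: `RepPrimeClass`, `mPrime`) and of `R90S9InnerFormSec146Packets` (edition 2: packets of record, `memPrime`, `evp` ∕ `evpRep` — scope-free, finite places only).

## Why a scope (R90-IF-audit1 PRE-AUDIT FLAG «FRAME ∕ K_c SCOPE» 21:38:39Z, RULING R90-IF-plan 21:39:45Z (1)–(2))
The cell's archimedean trace currency (★ `archTr₀` on the bi-`K_c`-invariant tests ★ `ArchTestKc L ι H T hT`, RULING V31 «compact places silenced») sees a discrete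
`π′` of `U(H)` with `π′_∞ ≅ σ ⊠ ρ` (`σ` of `U(H_ι) ≅ U(2,1)`, `ρ` of `K_c = ∏_{w ≠ w(ι)} U(H_w) ≅ U(3)^{d-1}`) only through `σ ⊠ 𝟙`; the genuine character of `σ ⊠ ρ`
on such tests is `0` for `ρ ≠ 𝟙` (`∫_{K_c} ρ = 0`).  Hence the §14.6 carpet instance `Γ₀` — at a FRAMED `H` (`Tᴴ H^ι T = J`, `H^τ′ ≻ 0` for `τ′ ≠ ι`), the only
case the HC_CM consumer `Db_T_of_organsW1Sc` instantiates — carries the `K_c`-SPHERICAL classes (`ρ = 𝟙`), on which `archTr₀ ⊗ ∏ tr` IS the true character and the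
component map `π′ ↦ (σ, (π′_v)_v)` is injective (R90-IF-p02 #8′).  The complement is the honest residual leaf `SocketDefiniteAeRigidityOffScope` of B ED. 4 (no payer in
cell currency, not consumed).

## Answers (i)–(iii) asked of the datum by R90-IF-audit1 21:38:39Z (OF RECORD, RULING 21:39:45Z (2))
(i) CLASSES CARRIED: edition 1's `RepPrimeClass L H μA` = ALL unitary-equivalence classes of discrete automorphic representations stays FROZEN; `Γ₀` carries
`Rep′ := RepPrimeSph L ι H T hT μA` = the `K_c`-spherical classes (this file), `m′ := mPrimeSph` (edition 1's `mPrime` restricted; `≠ 0` for anisotropic `H`,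
`mPrimeSph_ne_zero`), `U := univ` of the subtype.  (ii) `Γ₀.tr′` at `∞` is NOT defined by this seat (OWED, S2 currency): of record it is `archTr₀ [σ] ⊗ ∏ᶠ_v tr π′_v` on
`ArchTestKc` = the TRUE character on `K_c`-spherical classes; «non-spherical classes have trace `0` against bi-`K_c`-invariant tests, so print's sums over all discrete `π′`
ARE sums over `Rep′_sph`» is a LEMMA for a proof file (★ `F0P3TraceFactorisationKcIdempotent` ∕ `…KcInvariance` currency), never a binder.  (iii) `(ι, T, hT)` enter ONLY
as the explicit binders of `IsKcSpherical` ∕ `RepPrimeSph`, in the consumer's bytes (`DbTSAtRecordW1` ∕ `StubThetaLiftMemberW1` :2–:3); `hdef`, `h2` are needed by no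
definition and enter the datum assembly as SECTION VARIABLES token-identical to ★ p862002 `globalCharactersLinIndep` :78–:80.

## Contents (namespace `Summit.HodgeConjecture.HodgeConjecture.R90.S9.InnerFormSec146`)
* **`IsKcSpherical L ι H T hT μA P`** — text of R90-IF-typ2 21:43:35Z VERBATIM (adopted bytewise by R90-IF-p02 #8′ `R90S9SphericalClassComponentsInjective` and by B ED. 4
  `Scope`); `isKcSpherical_of_areUnitarilyEquivalent`, `isKcSpherical_iff_of_areUnitarilyEquivalent` (descends along `classOf`);
* `IsKcSphericalClass` (+ `isKcSphericalClass_classOf`), **`RepPrimeSph L ι H T hT μA`** (+ `classOfSph`, `coe_classOfSph`, `exists_eq_classOfSph`),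
  `mPrimeSph` (+ `mPrimeSph_classOfSph`, `mPrimeSph_ne_zero`).
HONEST LABEL: bookkeeping definitions; proves no printed statement about automorphic forms; a scope split moves no digit; HC_CM is proved only modulo the 7 printed
citations (2 remaining named inputs: hLiu418 = `stmt-HodgeConjecture-24832`, h413 = `stmt-HodgeConjecture-24833`) until rung 0 closes.

## References
* [Rogawski1990] J. D. Rogawski, *Automorphic Representations of Unitary Groups in Three Variables*, Ann. of Math. Stud. 123 (1990), §14.2 p. 232; §14.5 p. 237; §14.6 p. 244.
* [BorelJacquet1979] A. Borel, H. Jacquet, *Automorphic forms and automorphic representations*, Proc. Sympos. Pure Math. 33.1 (1979), §4.6.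
* [Dixmier1977] J. Dixmier, *C*-algebras* (1977), §13.1.3 (unitary equivalence).
* [DeitmarEchterhoff2014] A. Deitmar, S. Echterhoff, *Principles of Harmonic Analysis*, 2nd ed. (2014), Thm. 9.2.2.
-/

set_option autoImplicit false
set_option linter.dupNamespace false  -- the mandated namespace repeats the summit's segment (`HodgeConjecture.HodgeConjecture`)

noncomputable section

open NumberField IsDedekindDomain MeasureTheory
open scoped Matrix MatrixGroups
open Literature.NumberTheory Literature.NumberTheory.Automorphic Literature.NumberTheory.Automorphic.UnitaryGroup
open Literature.NumberTheory.Automorphic.UnitaryGroup.CotangentForms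
open Summit.HodgeConjecture.HodgeConjecture.Cruxes.H413

namespace Summit.HodgeConjecture.HodgeConjecture.R90.S9.InnerFormSec146

/-! ## §9 The scope predicate `IsKcSpherical` and its descent to classes -/

section Scope

/-- **`P_∞` is `K_c`-SPHERICAL**: the compact archimedean factor `K_c = cmCompactFactor L ι H T hT ≅ ∏_{w ≠ w(ι)} U(H^{σ_w})` (★ `UnitaryGroupCohomologicalForms`) acts TRIVIALLY on
the discrete automorphic representation `P ⊂ L²(U(H)(L⁺)\U(H)(𝔸), μA)` — the Hilbert-space spelling of «`π′_∞ ≅ σ ⊠ 𝟙_{K_c}`», i.e. of `ρ = 𝟙` in `π′_∞ ≅ σ ⊠ ρ`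
(★ `DiscreteAutomorphicRep.rightRegular_eq_self_of_normal` propagates it from ONE non-zero `K_c`-fixed vector).  Binder bytes = the consumer's (`DbTSAtRecordW1` ∕
`StubThetaLiftMemberW1` for `ι T hT`; (AE-ⅱ) B for `μA P`), text of R90-IF-typ2 2026-09-04T21:43:35Z VERBATIM (adopted by R90-IF-p02 #8′ and B ED. 4 `Scope`).
In print the classes outside this scope contribute `0` to every trace against a bi-`K_c`-invariant test function (`∫_{K_c} ρ = 0` for `ρ ≠ 𝟙`), so the sums of §14.6 over
«all discrete `π′`» against such tests ARE sums over the `K_c`-spherical classes. [cite: Rogawski1990, §14.6 p. 244; §14.2 p. 232] [cite: BorelJacquet1979, §4.6] -/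
def IsKcSpherical (L : Type) [Field L] [NumberField L] [IsCMField L] (ι : L →+* ℂ) (H : Matrix (Fin 3) (Fin 3) L) (T : GL (Fin 3) ℂ)
    (hT : (T : Matrix (Fin 3) (Fin 3) ℂ)ᴴ * H.map ι * (T : Matrix (Fin 3) (Fin 3) ℂ) = Literature.Geometry.ComplexHyperbolic.BallModel.J)
    (μA : Measure (adelicGroupData (↥(maximalRealSubfield L)) L (IsCMField.complexConj L) 3 H).automorphicQuotient)
    [(adelicGroupData (↥(maximalRealSubfield L)) L (IsCMField.complexConj L) 3 H).IsAutomorphicMeasure μA]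
    (P : DiscreteAutomorphicRep (adelicGroupData (↥(maximalRealSubfield L)) L (IsCMField.complexConj L) 3 H) μA) : Prop :=
  ∀ k ∈ cmCompactFactor L ι H T hT, ∀ v ∈ P.space, (adelicGroupData (↥(maximalRealSubfield L)) L (IsCMField.complexConj L) 3 H).rightRegular μA k v = v

variable {L : Type} [Field L] [NumberField L] [IsCMField L] {ι : L →+* ℂ} {H : Matrix (Fin 3) (Fin 3) L} {T : GL (Fin 3) ℂ}
  {hT : (T : Matrix (Fin 3) (Fin 3) ℂ)ᴴ * H.map ι * (T : Matrix (Fin 3) (Fin 3) ℂ) = Literature.Geometry.ComplexHyperbolic.BallModel.J}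
  {μA : Measure (adelicGroupData (↥(maximalRealSubfield L)) L (IsCMField.complexConj L) 3 H).automorphicQuotient}
  [(adelicGroupData (↥(maximalRealSubfield L)) L (IsCMField.complexConj L) 3 H).IsAutomorphicMeasure μA]

/-- **`K_c`-sphericality travels along unitary equivalence**: if `e : P ≃ Q` intertwines the right-regular actions and `K_c` fixes `P` pointwise, it fixes `Q` pointwise
(`R(k) (e u) = e (R(k) u) = e u`). [cite: Dixmier1977, §13.1.3] [cite: BorelJacquet1979, §4.6] -/
theorem isKcSpherical_of_areUnitarilyEquivalent
    (P Q : DiscreteAutomorphicRep (adelicGroupData (↥(maximalRealSubfield L)) L (IsCMField.complexConj L) 3 H) μA)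
    (h : ContRepresentation.AreUnitarilyEquivalent P.space.toContRep Q.space.toContRep) (hP : IsKcSpherical L ι H T hT μA P) :
    IsKcSpherical L ι H T hT μA Q := by
  obtain ⟨φ, -⟩ := h
  have he : ∀ (g : (adelicGroupData (↥(maximalRealSubfield L)) L (IsCMField.complexConj L) 3 H).Adelic) (w : P.space.toSubmodule),
      φ.toContinuousLinearEquiv (P.space.toContRep g w) = Q.space.toContRep g (φ.toContinuousLinearEquiv w) :=
    fun g w => congrArg (fun f : P.space.toSubmodule →L[ℂ] Q.space.toSubmodule => f w) (φ.isIntertwining g)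
  intro k hk v hv
  -- pull `v ∈ Q` back to `u := e⁻¹ v ∈ P`, which `k` fixes
  have hu : P.space.toContRep k (φ.toContinuousLinearEquiv.symm ⟨v, hv⟩) = φ.toContinuousLinearEquiv.symm ⟨v, hv⟩ :=
    Subtype.ext (hP k hk _ (φ.toContinuousLinearEquiv.symm ⟨v, hv⟩).2)
  have h1 := he k (φ.toContinuousLinearEquiv.symm ⟨v, hv⟩)
  rw [hu, ContinuousLinearEquiv.apply_symm_apply] at h1
  have h2 := congrArg Subtype.val h1
  exact h2.symm

/-- `K_c`-sphericality is INVARIANT under unitary equivalence (both directions of `isKcSpherical_of_areUnitarilyEquivalent`). [cite: Dixmier1977, §13.1.3] -/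
theorem isKcSpherical_iff_of_areUnitarilyEquivalent
    (P Q : DiscreteAutomorphicRep (adelicGroupData (↥(maximalRealSubfield L)) L (IsCMField.complexConj L) 3 H) μA)
    (h : ContRepresentation.AreUnitarilyEquivalent P.space.toContRep Q.space.toContRep) :
    IsKcSpherical L ι H T hT μA P ↔ IsKcSpherical L ι H T hT μA Q :=
  ⟨isKcSpherical_of_areUnitarilyEquivalent P Q h, isKcSpherical_of_areUnitarilyEquivalent Q P h.symm⟩

variable (L : Type) [Field L] [NumberField L] [IsCMField L] (ι : L →+* ℂ) (H : Matrix (Fin 3) (Fin 3) L) (T : GL (Fin 3) ℂ)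
  (hT : (T : Matrix (Fin 3) (Fin 3) ℂ)ᴴ * H.map ι * (T : Matrix (Fin 3) (Fin 3) ℂ) = Literature.Geometry.ComplexHyperbolic.BallModel.J)
  (μA : Measure (adelicGroupData (↥(maximalRealSubfield L)) L (IsCMField.complexConj L) 3 H).automorphicQuotient)
  [(adelicGroupData (↥(maximalRealSubfield L)) L (IsCMField.complexConj L) 3 H).IsAutomorphicMeasure μA]

/-- **`K_c`-sphericality of a CLASS `π′ ∈ Rep′`** (descended along `classOf` by `isKcSpherical_iff_of_areUnitarilyEquivalent`). [cite: Rogawski1990, §14.6 p. 244] [cite: Dixmier1977, §13.1.3] -/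
def IsKcSphericalClass (π' : RepPrimeClass L H μA) : Prop :=
  Quotient.liftOn π' (IsKcSpherical L ι H T hT μA) fun P Q h => propext (isKcSpherical_iff_of_areUnitarilyEquivalent P Q h)

/-- `IsKcSphericalClass [P] ↔ IsKcSpherical P` (unfolding). [cite: Rogawski1990, §14.6 p. 244] -/
theorem isKcSphericalClass_classOf (P : DiscreteAutomorphicRep (adelicGroupData (↥(maximalRealSubfield L)) L (IsCMField.complexConj L) 3 H) μA) :
    IsKcSphericalClass L ι H T hT μA (classOf L H μA P) ↔ IsKcSpherical L ι H T hT μA P :=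
  Iff.rfl

/-- **`Rep′_sph`** — the SCOPE of the §14.6 carpet instance `Γ₀` (RULING 21:39:45Z (2)(i)): the `K_c`-spherical unitary-equivalence classes of discrete automorphic
representations of `U(H)` (edition 1's `RepPrimeClass` stays frozen = ALL classes). [cite: Rogawski1990, §14.6 p. 244; §14.5 p. 237] -/
def RepPrimeSph : Type := {π' : RepPrimeClass L H μA // IsKcSphericalClass L ι H T hT μA π'}

/-- The class in `Rep′_sph` of a `K_c`-spherical discrete `P`. [cite: Rogawski1990, §14.5 p. 237] -/
def classOfSph (P : DiscreteAutomorphicRep (adelicGroupData (↥(maximalRealSubfield L)) L (IsCMField.complexConj L) 3 H) μA) (hP : IsKcSpherical L ι H T hT μA P) :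
    RepPrimeSph L ι H T hT μA :=
  ⟨classOf L H μA P, hP⟩

/-- `(classOfSph P hP).1 = classOf P` (unfolding). [cite: Rogawski1990, §14.5 p. 237] -/
theorem coe_classOfSph (P : DiscreteAutomorphicRep (adelicGroupData (↥(maximalRealSubfield L)) L (IsCMField.complexConj L) 3 H) μA) (hP : IsKcSpherical L ι H T hT μA P) :
    (classOfSph L ι H T hT μA P hP).1 = classOf L H μA P :=
  rfl

/-- Every element of `Rep′_sph` is the class of a `K_c`-spherical discrete `P`. [cite: Rogawski1990, §14.5 p. 237] -/
theorem exists_eq_classOfSph (π' : RepPrimeSph L ι H T hT μA) :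
    ∃ (P : DiscreteAutomorphicRep (adelicGroupData (↥(maximalRealSubfield L)) L (IsCMField.complexConj L) 3 H) μA) (hP : IsKcSpherical L ι H T hT μA P),
      classOfSph L ι H T hT μA P hP = π' := by
  obtain ⟨c, hc⟩ := π'
  obtain ⟨P, rfl⟩ := classOf_surjective L H μA c
  exact ⟨P, hc, rfl⟩

/-- **`m(π′)` on the scope**: the multiplicity of a `K_c`-spherical class (edition 1's `mPrime` restricted). [cite: Rogawski1990, §14.5 p. 237] -/
def mPrimeSph (π' : RepPrimeSph L ι H T hT μA) : ℕ :=
  mPrime L H μA π'.1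

/-- `m′_sph (classOfSph P hP) = m′ [P]` (unfolding). [cite: Rogawski1990, §14.5 p. 237] -/
theorem mPrimeSph_classOfSph (P : DiscreteAutomorphicRep (adelicGroupData (↥(maximalRealSubfield L)) L (IsCMField.complexConj L) 3 H) μA) (hP : IsKcSpherical L ι H T hT μA P) :
    mPrimeSph L ι H T hT μA (classOfSph L ι H T hT μA P hP) = mPrime L H μA (classOf L H μA P) :=
  rfl

/-- **`m(π′) ≠ 0` on the scope, for anisotropic `H`** (edition 1's `mPrime_ne_zero`). [cite: Rogawski1990, §14.5 p. 237] [cite: DeitmarEchterhoff2014, Thm. 9.2.2] -/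
theorem mPrimeSph_ne_zero (hanis : ∀ x : Fin 3 → L, Literature.AlgebraicGeometry.ShimuraVarieties.hermForm (cmConjRingHom L) H x x = 0 → x = 0)
    (π' : RepPrimeSph L ι H T hT μA) : mPrimeSph L ι H T hT μA π' ≠ 0 := by
  obtain ⟨P, hP, rfl⟩ := exists_eq_classOfSph L ι H T hT μA π'
  exact mPrime_ne_zero L H μA hanis P

end Scope

/-! ## §10 (ED. 2, append-only; RULING S9-R-b′ 2026-09-04T22:09:02Z) The `K_c` GUARD on the TEST-FUNCTION side: bi-`K_c`-invariant `f′ ∈ C_c(G′(𝔸))` -/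

section TestSide

/-- **`f′` is bi-`K_c`-INVARIANT**: `f′(k g) = f′(g) = f′(g k)` for all `k` in the compact archimedean factor `K_c = cmCompactFactor L ι H T hT` and all `g ∈ G′(𝔸) = U(H)(𝔸)`
(`f′ : C_c(G′(𝔸))`, the engine's `TG′`; the element token `k : (cmDatum L 3 H).Adelic` with `k ∈ cmCompactFactor …` is the one of ★ `F0P3TraceFactorisationKcInvariance`).
The test-side twin of `IsKcSpherical` (RULING S9-R-b′, R90-IF-audit1 FLAG W1): every §14.6 identity equating the FULL trace `θ_{G′}(f′)` with a sum over the `K_c`-spherical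
classes is asked only at such `f′` (`π′(f′) = 0` on a non-spherical irreducible `π′` for bi-`K_c`-invariant `f′`, `K_c` being normal); the cell's tests `tens₀ φ f`
(`f′_∞ = f_ι ⊗ e_{K_c}`) satisfy it.  Pin of record: `Transfer₀ := fun f' f => IsKcBiInv L ι H T hT f' ∧ 𝔨.Smooth f' ∧ 𝔨.Transfer f' f`.
[cite: Rogawski1990, §14.2 p. 233; §14.6 p. 244] [cite: BorelJacquet1979, §4.1] -/
def IsKcBiInv (L : Type) [Field L] [NumberField L] [IsCMField L] (ι : L →+* ℂ) (H : Matrix (Fin 3) (Fin 3) L) (T : GL (Fin 3) ℂ)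
    (hT : (T : Matrix (Fin 3) (Fin 3) ℂ)ᴴ * H.map ι * (T : Matrix (Fin 3) (Fin 3) ℂ) = Literature.Geometry.ComplexHyperbolic.BallModel.J)
    (f' : CompactlySupportedContinuousMap (cmDatum L 3 H).Adelic ℂ) : Prop :=
  ∀ k : (cmDatum L 3 H).Adelic, k ∈ cmCompactFactor L ι H T hT → ∀ g : (cmDatum L 3 H).Adelic, f' (k * g) = f' g ∧ f' (g * k) = f' g

variable {L : Type} [Field L] [NumberField L] [IsCMField L] {ι : L →+* ℂ} {H : Matrix (Fin 3) (Fin 3) L} {T : GL (Fin 3) ℂ}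
  {hT : (T : Matrix (Fin 3) (Fin 3) ℂ)ᴴ * H.map ι * (T : Matrix (Fin 3) (Fin 3) ℂ) = Literature.Geometry.ComplexHyperbolic.BallModel.J}

/-- Left invariance extracted: `f′(k g) = f′(g)`. [cite: BorelJacquet1979, §4.1] -/
theorem IsKcBiInv.apply_mul_left {f' : CompactlySupportedContinuousMap (cmDatum L 3 H).Adelic ℂ} (hf : IsKcBiInv L ι H T hT f')
    {k : (cmDatum L 3 H).Adelic} (hk : k ∈ cmCompactFactor L ι H T hT) (g : (cmDatum L 3 H).Adelic) : f' (k * g) = f' g :=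
  (hf k hk g).1

/-- Right invariance extracted: `f′(g k) = f′(g)`. [cite: BorelJacquet1979, §4.1] -/
theorem IsKcBiInv.apply_mul_right {f' : CompactlySupportedContinuousMap (cmDatum L 3 H).Adelic ℂ} (hf : IsKcBiInv L ι H T hT f')
    {k : (cmDatum L 3 H).Adelic} (hk : k ∈ cmCompactFactor L ι H T hT) (g : (cmDatum L 3 H).Adelic) : f' (g * k) = f' g :=
  (hf k hk g).2

/-- A two-sided-invariance constructor: `f′` left- and right-invariant under `K_c` separately is bi-`K_c`-invariant. [cite: BorelJacquet1979, §4.1] -/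
theorem IsKcBiInv.of_left_right {f' : CompactlySupportedContinuousMap (cmDatum L 3 H).Adelic ℂ}
    (hl : ∀ k : (cmDatum L 3 H).Adelic, k ∈ cmCompactFactor L ι H T hT → ∀ g : (cmDatum L 3 H).Adelic, f' (k * g) = f' g)
    (hr : ∀ k : (cmDatum L 3 H).Adelic, k ∈ cmCompactFactor L ι H T hT → ∀ g : (cmDatum L 3 H).Adelic, f' (g * k) = f' g) :
    IsKcBiInv L ι H T hT f' :=
  fun k hk g => ⟨hl k hk g, hr k hk g⟩

end TestSide

/-! ## §11 (ED. 3, append-only) The FEEDER of the scope predicate: ONE non-zero `K_c`-fixed vector suffices (R90-IF-audit1 PROBE 2026-09-04T21:59:21Z) -/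

section Feeder

variable {L : Type} [Field L] [NumberField L] [IsCMField L] {ι : L →+* ℂ} {H : Matrix (Fin 3) (Fin 3) L} {T : GL (Fin 3) ℂ}
  {hT : (T : Matrix (Fin 3) (Fin 3) ℂ)ᴴ * H.map ι * (T : Matrix (Fin 3) (Fin 3) ℂ) = Literature.Geometry.ComplexHyperbolic.BallModel.J}
  {μA : Measure (adelicGroupData (↥(maximalRealSubfield L)) L (IsCMField.complexConj L) 3 H).automorphicQuotient}
  [(adelicGroupData (↥(maximalRealSubfield L)) L (IsCMField.complexConj L) 3 H).IsAutomorphicMeasure μA]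

/-- **A discrete `P` with ONE non-zero `K_c`-fixed vector is `K_c`-SPHERICAL**: `K_c = cmCompactFactor L ι H T hT` is NORMAL in `U(H)(𝔸)` (★ `normal_cmCompactFactor`), so the
`K_c`-fixed vectors of the irreducible `P` are all of `P` as soon as they are non-zero (★ `DiscreteAutomorphicRep.rightRegular_eq_self_of_normal`).  The payer's road from a
`K_c`-invariant theta ∕ cotangent form to the scope `IsKcSpherical` of `Γ₀^{sph}`. [cite: BorelJacquet1979, §4.6] [cite: DeitmarEchterhoff2014, Thm. 7.3.2] -/
theorem isKcSpherical_of_exists_fixed (P : DiscreteAutomorphicRep (adelicGroupData (↥(maximalRealSubfield L)) L (IsCMField.complexConj L) 3 H) μA)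
    {v₀ : (adelicGroupData (↥(maximalRealSubfield L)) L (IsCMField.complexConj L) 3 H).L2 μA} (hv₀ : v₀ ∈ P.space) (hne : v₀ ≠ 0)
    (hfix : ∀ k ∈ cmCompactFactor L ι H T hT, (adelicGroupData (↥(maximalRealSubfield L)) L (IsCMField.complexConj L) 3 H).rightRegular μA k v₀ = v₀) :
    IsKcSpherical L ι H T hT μA P :=
  P.rightRegular_eq_self_of_normal (normal_cmCompactFactor L ι H T hT) hv₀ hne hfix

end Feeder

end Summit.HodgeConjecture.HodgeConjecture.R90.S9.InnerFormSec146

end
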